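import Literature.Probability.Percolation.AnnulusOrderTransfer
import Literature.Probability.Percolation.AnnulusHookup
import HarnessLib

/-!
# The keyhole lemma: outside a hexagonal hole, a connected obstacle separates the ring arcs it cuts

Crux `Summit.CriticalPhenomena.CardyFormulaZ2.Theses.CardyMagicRigidity.NestingRigidity` (stmt-CriticalPhenomena-4835),
line `pinch-resampling` v4, stub S10' `stub_neckTomographyV4`.  The EXTERIOR Jordan-type input of the planar core of
`TSwitchPlanar` (`tSwitchPlanar_of_core`, `…NestingRigidityTomographySwitchReduction`, p166124): the tree's disc
lemma `triBall_not_interleaved_shift` forbids interleaved paths of disjoint classes INSIDE a hexagon; the switch needs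
the same OUTSIDE the hole `Λ_{n-1}`, where paths may wind around the hole.  Registered anchor `keyhole_not_joined`:

Let `B ⊆ {n ≤ |·| ≤ M}` (`1 ≤ n < M`) be connected from a site `a ∈ ∂Λ_n` and reach `∂Λ_M`, and let `σ₁, σ₂ ∈ ∂Λ_n`
be joined by a path of `{n ≤ |·| ≤ M} ∖ B`.  Then `σ₁, σ₂` are already joined along the ring `∂Λ_n ∖ B`.

Proof (no winding numbers): with `B` as a fake configuration, the component `U` of `σ₁` in `Λ_M ∖ B` — which contains
the whole hole — is a disc of hexagons (`exists_isTriDisc_of_coconnected`, `ballComp_coconnected`: `B` joins the hole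
to the outside).  Let `p` be the first site of `B` met clockwise from `σ₁` on `∂Λ_n`, `p'` its anticlockwise ring
neighbour and `h = apex (p → p')` the hole site under the ring edge `p p'`.  Then `(h, p)` is a boundary dart of `U`
whose successor in the anticlockwise boundary traversal is `(p', p)` (the apex of `h → p` is `p' ∈ U`).  The same at
`σ₂` gives darts `(h_q, q)`, `(q', q)`; if `σ₁, σ₂` are not ring-joined off `B` then `p ≠ q`, so based at `(h, p)` the
four darts sit at positions `0 < 1 < m < m + 1`, while `h ⇝ h_q` through the hole and `p' ⇝ σ₁ ⇝ σ₂ ⇝ q'` off the hole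
are paths of `U` of complementary classes — excluded by `IsTriDisc.not_interleaved` (Bollobás–Riordan, Ch. 7 Lemma 5).

Also: `PathIn.exists_norm_le` (a path is bounded), `exists_ccwNb_innerApex` (ring edges have an apex in the hole),
`pathIn_through_hole`.  Sorry-free; no `Prop` definition is introduced.
-/

noncomputable section

namespace Summit.CriticalPhenomena.CardyFormulaZ2.Cruxes.NestingRigidity.PinchResampling

open Finset Literature.Probability.Percolation Literature.Probability.LatticeModels

/-! ## §1 Small lattice lemmas -/

section Small

/-- **A lattice path is bounded**: it runs inside `A ∩ Λ_K` for some `K`. -/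
theorem _root_.Literature.Probability.Percolation.PathIn.exists_norm_le {A : Set (Site 2)} {u v : Site 2}
    (h : PathIn triGraph A u v) : ∃ K : ℕ, PathIn triGraph (A ∩ {w | triNorm w ≤ K}) u v := by
  obtain ⟨hu, h⟩ := h
  induction h with
  | refl => exact ⟨(triNorm u).toNat, PathIn.refl ⟨hu, show triNorm u ≤ _ by omega⟩⟩
  | @tail b c _ hbc ih =>
    obtain ⟨K, hK⟩ := ih
    refine ⟨max K (triNorm c).toNat, (hK.mono ?_).tail hbc.1 ⟨hbc.2, show triNorm c ≤ _ by push_cast; omega⟩⟩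
    intro w hw
    have : triNorm w ≤ K := hw.2
    exact ⟨hw.1, show triNorm w ≤ _ by push_cast; omega⟩

/-- The apex identity: the left apex of the dart from `apex (u → v)` back to `u` is `v`. -/
theorem triLeftApex_triLeftApex_left (u v : Site 2) : triLeftApex (triLeftApex u v) u = v := by
  ext j
  fin_cases j <;> simp [triLeftApex, triRot60_apply_zero, triRot60_apply_one] <;> ring

/-- **Ring edges have an apex in the hole**: every site `p ∈ ∂Λ_n` (`n ≥ 1`) has an anticlockwise ring neighbour
`p'` (shifted coordinate `1`), adjacent to it, and the apex of the dart `p → p'` lies in the hole `{|·| < n}`. -/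
theorem exists_ccwNb_innerApex {n : ℕ} (hn : 1 ≤ n) {p : Site 2} (hp : triNorm p = n) :
    ∃ p' : Site 2, triNorm p' = n ∧ hexShift n p p' = 1 ∧ triGraph.Adj p p' ∧ triNorm (triLeftApex p p') < n := by
  obtain ⟨i, hi, y, hy, hy0, rfl⟩ := exists_rot_side0 hn hp
  have hcc := ccwNb_side0 hn hy hy0
  refine ⟨triRotIsoPow i ![(n : ℤ), y + 1], ?_, (ccwNb_rot hn hi (triNorm_side0 hy hy0.le) hcc).2, ?_, ?_⟩
  · rw [triNorm_rot]; exact hcc.1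
  · rw [rot_adj_iff, triGraph_adj_iff_coord]; simp
  · rw [triLeftApex_rot, triNorm_rot, triLeftApex_vec, triNorm_lt_iff_lin]
    simp; omega

/-- **Joining two ring sites through the hole**: sites `u, v ∈ ∂Λ_n` (`n ≥ 1`) are joined inside
`{|·| < n} ∪ {u, v}`. -/
theorem pathIn_through_hole {n : ℕ} (hn : 1 ≤ n) {u v : Site 2} (hu : triNorm u = n) (hv : triNorm v = n) :
    PathIn triGraph ({w | triNorm w < n} ∪ {u, v}) u v := by
  obtain ⟨hᵤ, hadjᵤ, hhᵤ⟩ := exists_adj_mem_triBall_sub_one hn hu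
  obtain ⟨hᵥ, hadjᵥ, hhᵥ⟩ := exists_adj_mem_triBall_sub_one hn hv
  have hole : PathIn triGraph ({w | triNorm w < n} ∪ {u, v}) hᵤ hᵥ :=
    (pathIn_triBall hhᵤ hhᵥ).mono fun w hw ↦ Or.inl (by
      have := mem_triBall_iff.1 (Finset.mem_coe.1 hw); push_cast [hn] at this; simp; omega)
  exact ((PathIn.of_adj (by simp) hole.left_mem hadjᵤ).trans hole).tail hadjᵥ.symm (by simp)

end Small

/-! ## §2 The first obstacle site clockwise from a free ring site -/

section CwFirst

/-- **The first site of `B` clockwise from `σ` on `∂Λ_n`.**  For a bounded set `B` meeting `∂Λ_n` (at `a`) and a ring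
site `σ ∉ B`: a ring site `p ∈ B`, its anticlockwise ring neighbour `p'` with the apex of `p → p'` in the hole, such
that the anticlockwise arc from `p'` to `σ` avoids `B` (recorded both as a coordinate statement and as a ring path). -/
theorem exists_cwFirst {n M : ℕ} (hn : 1 ≤ n) {B : Set (Site 2)} (hBM : ∀ v ∈ B, triNorm v ≤ M)
    {a σ : Site 2} (ha : triNorm a = n) (haB : a ∈ B) (hσ : triNorm σ = n) (hσB : σ ∉ B) :
    ∃ p p' : Site 2, p ∈ B ∧ triNorm p = n ∧ triNorm p' = n ∧ triGraph.Adj p p' ∧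
      triNorm (triLeftApex p p') < n ∧ 1 ≤ hexShift n p σ ∧
      (∀ w : Site 2, triNorm w = n → 1 ≤ hexShift n p w → hexShift n p w ≤ hexShift n p σ → w ∉ B) ∧
      PathIn triGraph ({w | triNorm w = n} \ B) p' σ := by
  classical
  set S := (triBall M).filter (fun v ↦ triNorm v = n ∧ v ∈ B) with hS
  have memS : ∀ {v : Site 2}, v ∈ S ↔ triNorm v = n ∧ v ∈ B := fun {v} ↦ by
    rw [hS, mem_filter, mem_triBall_iff]
    exact ⟨fun h ↦ h.2, fun h ↦ ⟨hBM v h.2, h⟩⟩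
  obtain ⟨p, hpS, hpmax⟩ := S.exists_max_image (fun v ↦ hexShift n σ v) ⟨a, memS.2 ⟨ha, haB⟩⟩
  obtain ⟨hp, hpB⟩ := memS.1 hpS
  obtain ⟨p', hp', h1, hadj, hapex⟩ := exists_ccwNb_innerApex hn hp
  have rσp := hexShift_range hn hσ hp
  have rpσ := hexShift_range hn hp hσ
  -- `σ ≠ p`, in coordinates
  have hσp0 : hexShift n σ p ≠ 0 := fun e ↦ hσB (by
    rw [hexShift_injOn (r := σ) hn hσ hp (by rw [hexShift_self, e])]; exact hpB)
  have hpσ0 : hexShift n p σ ≠ 0 := fun e ↦ hσB (by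
    rw [← hexShift_injOn (r := p) hn hp hσ (by rw [hexShift_self, e])]; exact hpB)
  have hpσ : hexShift n p σ = 6 * n - hexShift n σ p := by
    rcases hexShift_rebase hn hσ hp hσ with e | e <;> rw [hexShift_self] at e <;> omega
  -- the anticlockwise arc `(p, σ]` avoids `B`
  have arc : ∀ w : Site 2, triNorm w = n → 1 ≤ hexShift n p w → hexShift n p w ≤ hexShift n p σ → w ∉ B := by
    intro w hw h1w hwσ hwB
    have hle : hexShift n σ w ≤ hexShift n σ p := hpmax w (memS.2 ⟨hw, hwB⟩)
    have hw0 : hexShift n σ w ≠ 0 := fun e ↦ hσB (by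
      rw [hexShift_injOn (r := σ) hn hσ hw (by rw [hexShift_self, e])]; exact hwB)
    have rσw := hexShift_range hn hσ hw
    rcases hexShift_rebase hn hσ hp hw with e | e <;> omega
  refine ⟨p, p', hpB, hp, hp', hadj, hapex, by omega, arc, ?_⟩
  -- the ring path from `p'` to `σ` along the arc
  refine (pathIn_sphere_arc hn hp' hσ).mono fun w hw ↦ ⟨hw.1, fun hwB ↦ ?_⟩
  have rpw := hexShift_range hn hp hw.1
  have rp'w := hexShift_range hn hp' hw.1
  have rp'σ := hexShift_range hn hp' hσ
  have hp'σ : hexShift n p' σ = hexShift n p σ - 1 := by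
    rcases hexShift_rebase hn hp hp' hσ with e | e <;> rw [h1] at e <;> omega
  have hle : hexShift n p' w ≤ hexShift n p' σ := hw.2
  by_cases hw1 : 1 ≤ hexShift n p w
  · refine arc w hw.1 hw1 ?_ hwB
    rcases hexShift_rebase hn hp hp' hw.1 with e | e <;> rw [h1] at e <;> omega
  · rcases hexShift_rebase hn hp hp' hw.1 with e | e <;> rw [h1] at e <;> omega

end CwFirst

/-! ## §3 The keyhole lemma (registered anchor) -/

section Keyhole

/-- **Registered anchor — the keyhole lemma.**  Let `1 ≤ n < M`, `B ⊆ {n ≤ |·| ≤ M}` connected from a ring site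
`a ∈ ∂Λ_n` (every site of `B` is joined to `a` inside `B`) and containing a site `z ∈ ∂Λ_M`.  If two ring sites
`σ₁, σ₂ ∈ ∂Λ_n` are joined by a path of `{n ≤ |·| ≤ M} ∖ B` (outside the hole, off the obstacle), then they are joined
along the ring `∂Λ_n ∖ B`.  (The component of `σ₁` in `Λ_M ∖ B` is a disc containing the hole; the boundary darts from
the hole into the first obstacle sites clockwise from `σ₁` and from `σ₂`, each followed by the dart from the free ring
neighbour, would be interleaved with a hole path against the exterior path: `IsTriDisc.not_interleaved`.) -/
theorem keyhole_not_joined :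
    ∀ {n M : ℕ}, 1 ≤ n → n < M → ∀ {B : Set (Site 2)} {a z σ₁ σ₂ : Site 2}, B ⊆ triAnn n M →
      (∀ v ∈ B, PathIn triGraph B a v) → triNorm a = n → z ∈ B → triNorm z = M → triNorm σ₁ = n → triNorm σ₂ = n →
      PathIn triGraph (triAnn n M \ B) σ₁ σ₂ → PathIn triGraph ({w | triNorm w = n} \ B) σ₁ σ₂ := by
  intro n M hn hnM B a z σ₁ σ₂ hB hconn ha hz hzM hσ₁ hσ₂ hC
  classical
  by_contra hsep
  have haB : a ∈ B := (hconn z hz).left_mem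
  have hBM : ∀ v ∈ B, triNorm v ≤ M := fun v hv ↦ (mem_triAnn.1 (hB hv)).2
  have hBn : ∀ v ∈ B, (n : ℤ) ≤ triNorm v := fun v hv ↦ (mem_triAnn.1 (hB hv)).1
  have hσ₁B : σ₁ ∉ B := hC.left_mem.2
  have hσ₂B : σ₂ ∉ B := hC.right_mem.2
  -- the fake configuration `B`: cluster `K ⊇ B` of `a` in `Λ_M`, component `U` of `σ₁` in `Λ_M ∖ K`
  set K := annCluster 0 M B a with hKdef
  set U := annComp 0 M B a σ₁ with hUdef
  set G := annCompFin 0 M B a σ₁ with hGdef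
  have hA0 : ∀ {v : Site 2}, triNorm v ≤ M → v ∈ triAnn 0 M := fun {v} hv ↦
    mem_triAnn.2 ⟨by have := triNorm_nonneg v; push_cast; omega, hv⟩
  have ring_sub : {w : Site 2 | triNorm w = n} \ B ⊆ triAnn n M \ B := fun v hv ↦ by
    have h1 : triNorm v = n := hv.1
    exact ⟨mem_triAnn.2 ⟨h1.ge, by omega⟩, hv.2⟩
  have hKB : K ⊆ B := fun v hv ↦ (annCluster_subset hv).2
  have hBK : B ⊆ K := fun v hv ↦ (hconn v hv).mono fun w hw ↦ ⟨hA0 (hBM w hw), hw⟩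
  have hzK : z ∈ K := hBK hz
  have hUK : ∀ v ∈ U, v ∉ K := fun v hv ↦ (annComp_subset hv).2
  -- paths of `{n ≤ |·| ≤ M} ∖ B` and of the hole are paths of `Λ_M ∖ K`
  have sub1 : triAnn n M \ B ⊆ triAnn 0 M \ K := fun v hv ↦ ⟨hA0 (mem_triAnn.1 hv.1).2, fun h ↦ hv.2 (hKB h)⟩
  have sub2 : {w : Site 2 | triNorm w < n} ⊆ triAnn 0 M \ K := fun v hv ↦
    ⟨hA0 (by have : triNorm v < n := hv; omega), fun h ↦ by have := hBn v (hKB h); have : triNorm v < n := hv; omega⟩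
  have hσ₁U : σ₁ ∈ U := PathIn.refl (sub1 hC.left_mem)
  have toU : ∀ {X : Set (Site 2)} {v : Site 2}, X ⊆ triAnn 0 M \ K → PathIn triGraph X σ₁ v → v ∈ U :=
    fun hX hp ↦ hp.mono hX
  have hole_sub : (↑(triBall (n - 1)) : Set (Site 2)) ⊆ {w | triNorm w < n} := fun w hw ↦ by
    have := mem_triBall_iff.1 (Finset.mem_coe.1 hw)
    push_cast [hn] at this
    show triNorm w < n; omega
  have holeU : ∀ h : Site 2, triNorm h < n → h ∈ U := by
    intro h hh
    obtain ⟨h₁, hadj₁, hh₁⟩ := exists_adj_mem_triBall_sub_one hn hσ₁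
    have hole : PathIn triGraph (triAnn 0 M \ K) h₁ h :=
      (pathIn_triBall hh₁ (by push_cast [hn]; omega)).mono fun w hw ↦ sub2 (hole_sub hw)
    exact toU subset_rfl ((PathIn.of_adj (sub1 hC.left_mem) hole.left_mem hadj₁).trans hole)
  -- `U` is a disc
  obtain ⟨b₀, hb₀⟩ := exists_isTriDisc_of_coconnected _ G rfl ⟨σ₁, mem_annCompFin.2 hσ₁U⟩
    (fun p hp q hq ↦ by rw [coe_annCompFin]; exact pathIn_annComp (mem_annCompFin.1 hp) (mem_annCompFin.1 hq))
    (ballComp_coconnected hzK hzM)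
  -- the first obstacle sites clockwise from `σ₁` and from `σ₂`
  obtain ⟨p, p', hpB, hp, hp', hpp', hapex, h1σ₁, arc₁, path₁⟩ := exists_cwFirst hn hBM ha haB hσ₁ hσ₁B
  obtain ⟨q, q', hqB, hq, hq', hqq', haqex, h1σ₂, arc₂, path₂⟩ := exists_cwFirst hn hBM ha haB hσ₂ hσ₂B
  -- `p ≠ q`: otherwise the two free arcs overlap and `σ₁`, `σ₂` are ring-joined off `B`
  have hpq : p ≠ q := by
    rintro rfl
    have r1 := hexShift_range hn hp hσ₁
    have r2 := hexShift_range hn hp hσ₂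
    have key : ∀ {u v : Site 2}, triNorm u = n → triNorm v = n → u ∉ B →
        1 ≤ hexShift n p u → hexShift n p u ≤ hexShift n p v →
        (∀ w : Site 2, triNorm w = n → 1 ≤ hexShift n p w → hexShift n p w ≤ hexShift n p v → w ∉ B) →
        PathIn triGraph ({w | triNorm w = n} \ B) u v := by
      intro u v hu hv huB h1u huv harc
      refine (pathIn_sphere_arc hn hu hv).mono fun w hw ↦ ⟨hw.1, fun hwB ↦ ?_⟩
      have hle := hw.2
      have rpw := hexShift_range hn hp hw.1
      have ruw := hexShift_range hn hu hw.1
      have rpv := hexShift_range hn hp hv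
      have ruv := hexShift_range hn hu hv
      have rpu := hexShift_range hn hp hu
      rcases hexShift_rebase hn hp hu hw.1 with e | e <;> rcases hexShift_rebase hn hp hu hv with e' | e' <;>
        exact harc w hw.1 (by omega) (by omega) hwB
    rcases le_total (hexShift n p σ₁) (hexShift n p σ₂) with hle | hle
    · exact hsep (key hσ₁ hσ₂ hσ₁B h1σ₁ hle arc₂)
    · exact hsep (key hσ₂ hσ₁ hσ₂B h1σ₂ hle arc₁).symm
  -- the boundary darts `(h_p, p)`, `(h_q, q)` and their successors `(p', p)`, `(q', q)`
  set hₚ := triLeftApex p p' with hhₚ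
  set h_q := triLeftApex q q' with hh_q
  have hp'U : p' ∈ U := toU (fun v hv ↦ sub1 (ring_sub hv)) path₁.symm
  have hq'U : q' ∈ U := toU sub1 (hC.trans (path₂.symm.mono ring_sub))
  have hpG : p ∉ G := fun h ↦ hUK p (mem_annCompFin.1 h) (hBK hpB)
  have hqG : q ∉ G := fun h ↦ hUK q (mem_annCompFin.1 h) (hBK hqB)
  have heₚ : (hₚ, p) ∈ triBdryDarts G :=
    mem_triBdryDarts.2 ⟨mem_annCompFin.2 (holeU _ hapex), hpG, (triGraph_adj_triLeftApex_left hpp').symm⟩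
  have he_q : (h_q, q) ∈ triBdryDarts G :=
    mem_triBdryDarts.2 ⟨mem_annCompFin.2 (holeU _ haqex), hqG, (triGraph_adj_triLeftApex_left hqq').symm⟩
  have succₚ : triBdrySucc G (hₚ, p) = (p', p) := by
    unfold triBdrySucc; dsimp only
    rw [hhₚ, triLeftApex_triLeftApex_left, if_pos (mem_annCompFin.2 hp'U)]
  have succ_q : triBdrySucc G (h_q, q) = (q', q) := by
    unfold triBdrySucc; dsimp only
    rw [hh_q, triLeftApex_triLeftApex_left, if_pos (mem_annCompFin.2 hq'U)]
  -- positions along the boundary cycle based at `(h_p, p)`: `0, 1, m, m + 1`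
  have hD := hb₀.rebase heₚ
  obtain ⟨m, hm, hmq⟩ := hD.cycle _ he_q
  have it1 : triBdryIter G (hₚ, p) 1 = (p', p) := by rw [triBdryIter_one, succₚ]
  have itm1 : triBdryIter G (hₚ, p) (m + 1) = (q', q) := by rw [triBdryIter_succ, hmq, succ_q]
  have hm0 : m ≠ 0 := by
    rintro rfl
    rw [triBdryIter_zero] at hmq
    exact hpq (congrArg Prod.snd hmq)
  have hm1 : m ≠ 1 := by
    rintro rfl
    rw [it1] at hmq
    exact hpq (congrArg Prod.snd hmq)
  have hm2 : m + 1 < #(triBdryDarts G) := by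
    rcases Nat.lt_or_ge (m + 1) #(triBdryDarts G) with hlt | hge
    · exact hlt
    · exfalso
      have e : m + 1 = #(triBdryDarts G) := le_antisymm (Nat.succ_le_of_lt hm) hge
      have := itm1
      rw [e, hD.cycle_len] at this
      exact hpq (congrArg Prod.snd this)
  -- the hole path and the exterior path
  have hP : PathIn triGraph ((↑G : Set (Site 2)) ∩ {w | triNorm w < n}) hₚ h_q := by
    refine (pathIn_triBall (m := n - 1) (by push_cast [hn]; omega) (by push_cast [hn]; omega)).mono fun w hw ↦ ?_
    exact ⟨by rw [coe_annCompFin]; exact holeU w (hole_sub hw), hole_sub hw⟩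
  have hQ : PathIn triGraph ((↑G : Set (Site 2)) ∩ {w | triNorm w < n}ᶜ) p' q' := by
    have whole : PathIn triGraph (triAnn n M \ B) p' q' :=
      ((path₁.mono ring_sub).trans hC).trans (path₂.mono ring_sub).symm
    -- run it inside the set of sites reachable from `σ₁`, a subset of `U` off the hole
    have hreach : PathIn triGraph {w | PathIn triGraph (triAnn n M \ B) σ₁ w} p' q' :=
      ((path₁.mono ring_sub).symm.to_reach).symm.trans ((path₁.mono ring_sub).symm.trans whole).to_reach
    refine hreach.mono fun w hw ↦ ⟨?_, ?_⟩
    · rw [coe_annCompFin]; exact toU sub1 hw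
    · have := (mem_triAnn.1 (show PathIn triGraph (triAnn n M \ B) σ₁ w from hw).right_mem.1).1
      simp only [Set.mem_compl_iff, Set.mem_setOf_eq, not_lt]; exact this
  refine hD.not_interleaved {w | triNorm w < n} (n₁ := 0) (n₂ := 1) (n₃ := m) (n₄ := m + 1)
    zero_lt_one (by omega) (by omega) hm2 ?_ ?_
  · rw [triBdryIter_zero, hmq]; exact hP
  · rw [it1, itm1]; exact hQ

end Keyhole

end Summit.CriticalPhenomena.CardyFormulaZ2.Cruxes.NestingRigidity.PinchResampling

end
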